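/-
Origin: expansion seat `planner-pub-hodgecm-pv12-0`, handover 2026-08-18T03:27:30Z (`HOME/pub-hodgecm-pv12/lean/HodgeCM/PerL34/LineFieldCore.lean`, md5 c1953c2b, 192 lines);
landed by the gen-5 packager in gate run 18 as `HodgeCM/PerL34/UnitaryLines.lean` (verbatim).
-/
/-
Origin: HOME/pub-hodgecm-pv12/lean/HodgeCM/PerL34/LineFieldCore.lean — session planner-pub-hodgecm-pv12-0
(unit pub-hodgecm-pv12, DAG-node prover #12).  Intended final place: `HodgeCM/PerL34/LineFieldCore.lean`.
Pure Mathlib (v4.32.0); imports nothing of the package; asserts nothing (no axioms beyond the standard trio).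
-/
import Mathlib.Analysis.InnerProductSpace.PiL2
import Mathlib.Analysis.InnerProductSpace.Adjoint
import Mathlib.LinearAlgebra.LinearIndependent.Lemmas

set_option autoImplicit false

/-!
# The group-theoretic core of PerL v5 Prop 4.3 (`prop:S12`, tex ll. 639–684): no invariant line

PerL v5 (blob d912a121, `HOME/inputs/2001/…paper-v5…tex`) proves the non-vanishing of a wedge `u₁ ∧ u₂` of theta
one-forms by contradiction (tex ll. 664–683): if every wedge vanished, evaluation at a point `x₀ ∈ 𝔹²` would give

* (pointwise step, ll. 668–672) two nonzero spaces of cotangent vectors `𝒰₁(x₀), 𝒰₂(x₀) ⊂ T^*_{x₀}𝔹² ≅ ℂ²` all of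
  whose pairs are parallel, hence ONE line `ℓ(x₀)` containing both — `Submodule.eq_span_of_pairwise_dependent`
  below (pure linear algebra over any field: two nonzero subspaces all of whose pairs of vectors are linearly
  dependent coincide and are a line);
* (group step, ll. 672–683) a line in `T^*_{x₀}𝔹² ≅ ℂ²` invariant under the isotropy group `K_{x₀} ≅ U(2) × U(1)`
  acting through (a twist of) the standard representation of `U(2)` — "impossible, `SU(2)` is transitive on
  lines" — `Submodule.eq_bot_or_eq_top_of_forall_linearIsometryEquiv` below: in a finite-dimensional inner product
  space over `ℝ`/`ℂ` the full isometry group leaves no proper nonzero subspace invariant (for a nonzero proper `W`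
  an isometry swapping a unit vector of `W` with a unit vector of `Wᗮ` moves `W`), with the `finrank = 2`,
  `finrank W = 1` reading `Submodule.not_forall_linearIsometryEquiv_of_finrank_eq_one`.

The density step (real approximation, `G_U(L₀)` dense in `U(2,1)`: Sansuc Cor. 3.5(iii); Platonov–Rapinchuk
Thm 7.7) and the passage from `G_U(L₀)`-stable spaces of automorphic one-forms to `K_{x₀}`-stable value spaces are
NOT in this file (they need the automorphic model); this file is the Mathlib-checkable residue that any typing of
Prop 4.3's line-field argument ends in.
-/

namespace HodgeCM

namespace PerL34

open Module

/-! ### Pointwise step: pairwise dependent subspaces are one common line -/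

section PairwiseDependent

variable {K V : Type*} [Field K] [AddCommGroup V] [Module K V]

/-- If `v₁ ≠ 0` and the pair `(v₁, v₂)` is linearly dependent then `v₂` is a multiple of `v₁`. -/
theorem mem_span_of_not_linearIndependent_pair {v₁ v₂ : V} (hv₁ : v₁ ≠ 0)
    (h : ¬ LinearIndependent K ![v₁, v₂]) : v₂ ∈ K ∙ v₁ := by
  by_cases hv₂ : v₂ = 0
  · simp [hv₂]
  have h' : ¬ (v₂ ≠ 0 ∧ ∀ a : K, a • v₂ ≠ v₁) := by
    intro hc
    apply h
    rw [linearIndependent_fin2]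
    exact hc
  push Not at h'
  obtain ⟨a, ha⟩ := h' hv₂
  have ha0 : a ≠ 0 := by
    rintro rfl
    exact hv₁ (by simpa using ha.symm)
  rw [Submodule.mem_span_singleton]
  exact ⟨a⁻¹, by rw [← ha, smul_smul, inv_mul_cancel₀ ha0, one_smul]⟩

/-- **Pointwise step of PerL v5 Prop 4.3 (tex ll. 668–672).** Two nonzero subspaces `V₁, V₂` such that every
`v₁ ∈ V₁`, `v₂ ∈ V₂` are linearly dependent ("`u₁(x) ∧ u₂(x) = 0` for all `u₁, u₂`") coincide and are a line:
`V₁ = V₂ = K ∙ v` for some `v ≠ 0`. -/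
theorem _root_.Submodule.eq_span_of_pairwise_dependent (V₁ V₂ : Submodule K V) (h₁ : V₁ ≠ ⊥) (h₂ : V₂ ≠ ⊥)
    (h : ∀ v₁ ∈ V₁, ∀ v₂ ∈ V₂, ¬ LinearIndependent K ![v₁, v₂]) :
    ∃ v : V, v ≠ 0 ∧ V₁ = K ∙ v ∧ V₂ = K ∙ v := by
  obtain ⟨v₁, hv₁, hv₁0⟩ := Submodule.exists_mem_ne_zero_of_ne_bot h₁
  obtain ⟨v₂, hv₂, hv₂0⟩ := Submodule.exists_mem_ne_zero_of_ne_bot h₂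
  -- every vector of `V₂` is a multiple of `v₁`, every vector of `V₁` a multiple of `v₂`
  have hV₂ : V₂ ≤ K ∙ v₁ := fun w hw => mem_span_of_not_linearIndependent_pair hv₁0 (h v₁ hv₁ w hw)
  have hV₁ : V₁ ≤ K ∙ v₂ := by
    intro w hw
    refine mem_span_of_not_linearIndependent_pair hv₂0 ?_
    intro hli
    -- `![v₂, w]` independent ⇒ `![w, v₂]` independent, contradicting `h`
    apply h w hw v₂ hv₂
    have : ![w, v₂] = ![v₂, w] ∘ Equiv.swap 0 1 := by
      ext i
      fin_cases i <;> simp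
    rw [this]
    exact hli.comp _ (Equiv.injective _)
  have h21 : (K ∙ v₂) ≤ K ∙ v₁ := by
    rw [Submodule.span_singleton_le_iff_mem]
    exact hV₂ hv₂
  have h12 : (K ∙ v₁) ≤ K ∙ v₂ := by
    rw [Submodule.span_singleton_le_iff_mem]
    exact hV₁ hv₁
  have heq : (K ∙ v₁) = K ∙ v₂ := le_antisymm h12 h21
  refine ⟨v₁, hv₁0, le_antisymm (heq ▸ hV₁) ?_, le_antisymm hV₂ ?_⟩
  · rw [Submodule.span_singleton_le_iff_mem]
    exact hv₁
  · rw [heq, Submodule.span_singleton_le_iff_mem]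
    exact hv₂

end PairwiseDependent

/-! ### Group step: the isometry group leaves no proper nonzero subspace invariant -/

section NoInvariantLine

open scoped InnerProductSpace

variable {𝕜 : Type*} [RCLike 𝕜] {E : Type*} [NormedAddCommGroup E] [InnerProductSpace 𝕜 E]
  [FiniteDimensional 𝕜 E]

/-- For a proper nonzero subspace `W` of a finite-dimensional inner product space there is a linear isometry of the
space moving a vector of `W` out of `W` (swap a unit vector of `W` with a unit vector of `Wᗮ`). -/
theorem _root_.Submodule.exists_linearIsometryEquiv_map_not_mem (W : Submodule 𝕜 E) (h0 : W ≠ ⊥)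
    (h1 : W ≠ ⊤) : ∃ u : E ≃ₗᵢ[𝕜] E, ∃ w ∈ W, u w ∉ W := by
  classical
  obtain ⟨w, hwW, hw0⟩ := Submodule.exists_mem_ne_zero_of_ne_bot h0
  have hWo : Wᗮ ≠ ⊥ := fun h => h1 (Submodule.orthogonal_eq_bot_iff.1 h)
  obtain ⟨z, hzW, hz0⟩ := Submodule.exists_mem_ne_zero_of_ne_bot hWo
  set e₁ : E := (‖w‖⁻¹ : 𝕜) • w with he₁
  set e₂ : E := (‖z‖⁻¹ : 𝕜) • z with he₂
  have he₁W : e₁ ∈ W := W.smul_mem _ hwW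
  have he₂W : e₂ ∈ Wᗮ := Wᗮ.smul_mem _ hzW
  have hn₁ : ‖e₁‖ = 1 := norm_smul_inv_norm hw0
  have hn₂ : ‖e₂‖ = 1 := norm_smul_inv_norm hz0
  have h12 : ⟪e₁, e₂⟫_𝕜 = 0 := Submodule.inner_right_of_mem_orthogonal he₁W he₂W
  have h21 : ⟪e₂, e₁⟫_𝕜 = 0 := Submodule.inner_left_of_mem_orthogonal he₁W he₂W
  -- a vector of `W ∩ Wᗮ` is zero, so `e₂ ∉ W`
  have he₂notW : e₂ ∉ W := by
    intro h
    have h0 : ⟪e₂, e₂⟫_𝕜 = 0 := Submodule.inner_right_of_mem_orthogonal h he₂W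
    have : e₂ = 0 := inner_self_eq_zero.1 h0
    rw [this, norm_zero] at hn₂
    exact zero_ne_one hn₂
  have hne : e₁ ≠ e₂ := fun h => he₂notW (h ▸ he₁W)
  -- the orthonormal pair `{e₁, e₂}` extends to an orthonormal basis
  let s : Set E := {e₁, e₂}
  have hs : Orthonormal 𝕜 ((↑) : s → E) := by
    rw [orthonormal_subtype_iff_ite]
    intro v hv v' hv'
    simp only [s, Set.mem_insert_iff, Set.mem_singleton_iff] at hv hv'
    rcases hv with rfl | rfl <;> rcases hv' with rfl | rfl
    · simp [inner_self_eq_norm_sq_to_K, hn₁]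
    · simp [hne, h12]
    · simp [hne.symm, h21]
    · simp [inner_self_eq_norm_sq_to_K, hn₂]
  obtain ⟨t, b, hst, hb⟩ := hs.exists_orthonormalBasis_extension
  have h₁t : e₁ ∈ t := hst (by simp [s])
  have h₂t : e₂ ∈ t := hst (by simp [s])
  -- the isometry swapping `e₁` and `e₂` (and fixing the rest of the basis)
  let u : E ≃ₗᵢ[𝕜] E := b.equiv b (Equiv.swap (⟨e₁, h₁t⟩ : t) ⟨e₂, h₂t⟩)
  have hu : u e₁ = e₂ := by
    have hb₁ : b ⟨e₁, h₁t⟩ = e₁ := by rw [hb]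
    have hb₂ : b ⟨e₂, h₂t⟩ = e₂ := by rw [hb]
    have := b.equiv_apply_basis b (Equiv.swap (⟨e₁, h₁t⟩ : t) ⟨e₂, h₂t⟩) ⟨e₁, h₁t⟩
    rw [Equiv.swap_apply_left, hb₁, hb₂] at this
    exact this
  exact ⟨u, e₁, he₁W, hu ▸ he₂notW⟩

/-- **Group step of PerL v5 Prop 4.3 (tex ll. 672–683): no invariant proper subspace.** A subspace of a
finite-dimensional real or complex inner product space stable under every linear isometry is `⊥` or `⊤`
(the unitary / orthogonal group acts irreducibly; "`SU(2)` is transitive on lines"). -/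
theorem _root_.Submodule.eq_bot_or_eq_top_of_forall_linearIsometryEquiv (W : Submodule 𝕜 E)
    (hW : ∀ u : E ≃ₗᵢ[𝕜] E, ∀ w ∈ W, u w ∈ W) : W = ⊥ ∨ W = ⊤ := by
  by_contra h
  push Not at h
  obtain ⟨u, w, hw, hu⟩ := W.exists_linearIsometryEquiv_map_not_mem h.1 h.2
  exact hu (hW u w hw)

/-- The same for the unitary group `unitary (E →L[𝕜] E)` of the space (Mathlib's `Unitary.linearIsometryEquiv`
identifies it with the linear isometries; `CompleteSpace E` — automatic from finite dimension via
`FiniteDimensional.complete 𝕜 E` — is what gives `E →L[𝕜] E` its star structure). -/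
theorem _root_.Submodule.eq_bot_or_eq_top_of_forall_unitary [CompleteSpace E] (W : Submodule 𝕜 E)
    (hW : ∀ u ∈ unitary (E →L[𝕜] E), ∀ w ∈ W, (u : E →L[𝕜] E) w ∈ W) : W = ⊥ ∨ W = ⊤ := by
  refine W.eq_bot_or_eq_top_of_forall_linearIsometryEquiv fun u w hw => ?_
  have h := hW (Unitary.linearIsometryEquiv.symm u) (Unitary.linearIsometryEquiv.symm u).property w hw
  simpa using h

/-- **No invariant line in `ℂ²` (the form used by PerL, tex ll. 680–683).** In an inner product space of dimension
`2` no line (`finrank = 1` subspace) is stable under all linear isometries. -/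
theorem _root_.Submodule.not_forall_linearIsometryEquiv_of_finrank_eq_one (h2 : finrank 𝕜 E = 2)
    (W : Submodule 𝕜 E) (hW : finrank 𝕜 W = 1) :
    ¬ ∀ u : E ≃ₗᵢ[𝕜] E, ∀ w ∈ W, u w ∈ W := by
  intro h
  rcases W.eq_bot_or_eq_top_of_forall_linearIsometryEquiv h with rfl | rfl
  · simp at hW
  · rw [finrank_top, h2] at hW
    exact absurd hW (by norm_num)

end NoInvariantLine

end PerL34

end HodgeCM
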